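import Summits.QuantumFields.YangMills.Theorems.BalabanUVNodesN11Sect3SupplyChainBorelBThm1PrintedOfBgFacts
import Summits.QuantumFields.YangMills.Theorems.BalabanUVNodesN11CompatibleInitialSegmentSplit
import Literature.MathematicalPhysics.QuantumFieldTheory.Balaban1983to89.B16RLeafRecord13SepCoPH

/-!
# DAG node N11 — THE SPLIT bg SUPPLY ON THE SupplierBorel ROAD: along a windowed (2.6)-run the bg facts `∀ k ≤ K, BgProvisoΛ … k …` come from K0's GUARDED row on the
# COMPATIBLE INITIAL SEGMENT `k ≤ n₀` (dag-n11-w4 g5's two-regime split) and from a ONE-BLOCK PRODUCER asked ONLY on the top segment `n₀ < k ≤ K`; hence N11's node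
# `Dag.B14_main (leavesP w p)` on EVERY window run of a world from this seat's guard-free token (H3), the node's own (2.6) antecedent, and the one-block producer — the
# bg-fact binder of FILE 1 SHRUNK to the one-block levels, NO guard binder anywhere

HEADER — WORK-UNIT METADATA.  Cell `pub-ymgap`, YM-PLAN Track A (HUMAN RULING D-0062 ∕ D-0149 width seats), seat `pub-ymgap-dag-n11-w1` (g4; WIDTH SEAT 1 of 4 on NODE
n11 [B14]), route `BalabanUVNodes` rev 29, KEY item K1⁹ `StabilityBRunRowsAtRecordR13SepCoPHV` = stmt-QuantumFields-27364 (dag-lead KEY MAP v2; helper lane, `--kind proof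
--supports 27364 --as helper`, count-neutral; seat payload key K1⁷ 20542 = MIS-KEY fallback).  [III] = [Balaban1988Convergent], [I] = [Balaban1987RG1], [V] = [Balaban1989LargeFieldII],
[IV] = [Balaban1989LargeFieldI], [15] = [Balaban1985Variational].  Over this seat's H3 `…Sect3SupplyChainBorelBOfBgFacts` (p626869: `supplyChainAt_of_gaussCert_of_supplierBorel_of_bgFacts_of_powM`
— the guard-free token with the bg facts `hbgs` displayed per level), dag-n11-w4 g5's `…N11CompatibleInitialSegmentSplit` (p-landed: `exists_lastCompatibleLevel_of_window_of_flowIneq26` —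
under the window and (2.6) the compatible levels are an initial segment `≤ n₀` and every later level is ONE-BLOCK), def-T's `Node00.Record13SepCoPH` (row P11 `Provisos₁₃SepCoPH.bg`: the bg
facts at every COMPATIBLE level of a windowed run) and `B16RLeafRecord13SepCoPH` (`b14_main_at_record₁₃SepCoPH_of_liveSel`), dag-n11-e `…ObligationsDefs` (`thmP245Laws_of_supplyChainAt`).

WHY THIS FILE.  This seat's BorelB-road node layer has two halves: FILE 5 (`…NodeFaceOfCompatibleSupplierBorel`: runs whose TOP cube fits, K0's guarded row only) and FILE 1
(`…NodeFacesOfSupplierBorelOfBgFacts`: every window run, but the bg facts displayed at EVERY level `k ≤ K`).  dag-n11-w4 g5's split says more: along ONE windowed (2.6)-run the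
levels themselves split — compatible up to a last level `n₀`, one-block above (`exists_lastCompatibleLevel_of_window_of_flowIneq26`; «for dag-n11-w5 ∕ dag-n11-d ∕ dag-n11-w1: run
print's geometry up to `n₀` and the one-block geometry after it»).  THIS FILE types that consumer side for the BorelB road: (§1) a generic-chain node socket with BOTH of N11's own
antecedents threaded — `hN : window → (2.6) → SupplyChainAt θ p` (dag-n11-d g14 ∕ dag-n11-w4 g5 thread `smallCouplings` resp. `smallCouplings`+guard; here (2.6) itself is handed to
the chain); (§2) THE SPLIT bg SUPPLY: `∀ k ≤ K, BgProvisoΛ … k …` from the key's guarded row `h.bg` on `k ≤ n₀` (guard by the split, window `]0, w.γ] ⊆ ]0, θ.γ]`) and from a displayed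
ONE-BLOCK PRODUCER `hob` on the levels whose 𝐃_k-cube exceeds the torus — pure bookkeeping, no case left over; (§3) N11's node on EVERY window run of a world bound to the K1-keyed
datum (`w.γ ≤ θ.γ`, `0 ≤ w.βup`, `w.βup·w.γ² ≤ 1`, `M = L^a`, `r = 1`) from H3's rows with `hbgs` REPLACED by `hob` — per run and ∀ runs; (§4) the named certificate `gaussPinH θ`.
The one-block producer is inhabited in kind by dag-n11-w4 g4 p624439 `bgSepAt_of_thm1ScaledSep_of_powM` ∕ dag-n11-w5 p623895 (which give ALL levels; §2 asks them only above `n₀`).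

WHAT THIS FILE PROVES (6 theorems, 0 `def`, 0 `sorry`; standard axioms; compositions BY NAME + one case split).
§1 ★★ `b14_main_leavesP_of_supplyChainAt_of_window_of_flowIneq26` (generic chain, SepCoPH key; `hN : Step.InInterval w.γ p.K (gOfRecord₁₃ θ p) → B14.FlowIneq26 (gOfRecord₁₃ θ p) w.βup w.β₀ p.K →
   SupplyChainAt θ p`) · `b14_main_leavesP_all_of_supplyChainAt_of_window_of_flowIneq26`.
§2 ★★★ `bgFacts_of_guardedRow_of_oneBlockSupply_of_flowIneq26` (THE SPLIT SUPPLY).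
§3 ★★★ `b14_main_leavesP_of_gaussCert_of_supplierBorel_of_oneBlockSupply_of_powM` (per run) · ★★★ `b14_main_leavesP_all_of_gaussCert_of_supplierBorel_of_oneBlockSupply_of_powM` (∀ runs).
§4 ★★ `b14_main_leavesP_all_gaussPinH_of_supplierBorel_of_oneBlockSupply_of_powM`.

HONEST FRAMING.  Helper lane of K1⁹; count-neutral KERNEL BOOKKEEPING (one `by_cases` on the split level + compositions of landed theorems); every analytic row is a DISPLAYED
HYPOTHESIS exactly as in H3: the certificate, the K1-keyed `Provisos₁₃SepCoPH` (whose guarded row `bg` is K0's), the live-selector line, admissibility, signs, `0 < M₁ ≤ M`, `2 ≤ cR`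
(UNINHABITED at the witnesses of record; live at a cR-lettered member), `L·M₂ ∣ M`, `M = L^a`, `r = 1`, the world letters, and per windowed run the five numeric rows, K0's per-cube
[15]-solvability, [III] §3's supplier with `SupplierObligations ∧ SupplierBorel` (= Thm 2 proper — nobody's theorem) and the ONE-BLOCK bg PRODUCER ([III] (2.28) ∕ [15] Thm 1 content
at the one-block levels).  Nothing of Bałaban asserted; no statement about which `θ` carries the rows; no v9 stub touched; K1⁹ NOT closed; N11 NOT discharged; counts unmoved (typed
28∕28 · discharged 5∕27 · A 5∕28).  One finite `𝕋⁴_{L^K}` programme at fixed `ε = L^{−K}`; R4 closes only the conditional finite-𝕋⁴ rung `BalabanLadder.UV` — NOT ℝ⁴, NOT OS, NOT a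
mass gap, NOT Clay.  No `sorry`, `axiom`, `def`, `instance`, `notation`.
Sources (SHAPE ∕ bookkeeping only): [III] Thm 1 p.262, Theorem p.245, p.244 L36–38, §3 p.279, (2.1) p.254, (2.4)–(2.6) p.255, p.257 («compatible»), (2.28) p.259, (3.24)–(3.25) p.270;
[I] Thm 1 p.259, (0.20) p.256, (0.1) p.251; [V] Thm 1 p.355; [IV] (0.3)–(0.4) p.176, p.177 (i)–(ii); [15] Thm 1 (7)–(8) pp.278–279.
-/

noncomputable section

open MeasureTheory
open scoped BigOperators ENNReal NNReal Matrix.Norms.L2Operator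

namespace Summit.QuantumFields.YangMills.Theorems.BalabanUVNodesN11NodeFaceOfSplitBgSupplierBorel

open Literature.MathematicalPhysics.QuantumFieldTheory.Balaban1983to89 T4Continuum T4NestedCovariance Node00 Node00.Tk DagBinding
open B15DeterminingSets B8Eq17ClassAkV1 B14.Eq218Concrete B10Eq42TorusConstraint Step
open B14.Eq213MaximalDomains (side)
open B14.Eq213DetSet (Bj)
open Literature.MathematicalPhysics.QuantumFieldTheory.BalabanImbrieJaffe1984to88.BIJ85Eq453GaugeField (qsstarGIter0)
open Literature.MathematicalPhysics.QuantumFieldTheory.Balaban1983to89.B16RLeafRecord13SepCoPH (b14_main_at_record₁₃SepCoPH_of_liveSel)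
open BalabanUVNodesN11HistoryPinnedResidualDefs BalabanUVNodesN11RePinnedParamDefs
open BalabanUVNodesN11GaussianCertificateDefs (gaussPinH gaussPinH_ζ0 gaussPinH_quad)
open BalabanUVNodesN11Sect3SupplyChainDefs
open BalabanUVNodesN11Sect3SupplyChainBorelB
open BalabanUVNodesN11Sect3SupplyChainObligationsDefs
open BalabanUVNodesN11Sect3SupplyChainBorelBThm1PrintedOfSolvable (provisos₁₃SepCoPH_gaussPinH)
open BalabanUVNodesN11Sect3SupplyChainBorelBOfBgFacts (supplyChainAt_of_gaussCert_of_supplierBorel_of_bgFacts_of_powM)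
open BalabanUVNodesN11CompatibleInitialSegmentSplit (exists_lastCompatibleLevel_of_window_of_flowIneq26)

variable {F : T4Family} {N : ℕ} [NeZero N]

/-! ## §1  The socket with BOTH of N11's own antecedents threaded: `hN : window → (2.6) → SupplyChainAt θ p` -/

section Socket

variable {θ : Stage13HParams F N}

/-- **★★ N11's NODE FROM A CHAIN ASKED ONLY ON WINDOW RUNS OBEYING (2.6)** (generic chain; world bound to the K1-keyed SepCoPH datum of `θ` on the live-selector line): of the node's
antecedents `b7 … b11`, `smallCouplings`, `smallFieldInductive`, `flowControl`, the two that concern the record's couplings — the window `]0, w.γ]` and [III] (2.6) with the world's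
`(βup, β₀)` — are HANDED TO THE CHAIN (`(w.C P).flow.g = gOfRecord₁₃ θ P`, `rfl`); `1 ≤ M` from admissibility.  dag-n11-d g14 threads the window, dag-n11-w4 g5 the window + the
guard; here (2.6) itself. [cite: Balaban1988Convergent, Thm 1 p.262, Theorem p.245, p.244 L36–38, (2.6) p.255; Balaban1987RG1, (0.20) p.256; Balaban1989LargeFieldI, (0.3)–(0.4) p.176, p.177 (i)–(ii)] -/
theorem b14_main_leavesP_of_supplyChainAt_of_window_of_flowIneq26 (h : θ.Provisos₁₃SepCoPH F N)
    (hsel : θ.ppSel = ppSelLiveOfRecord F N θ.ν θ.τ9 (EOfRecord₁₃ F N θ.toStage13Params) (wOfRecord₉ F N θ.toStage9Params))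
    (hθ : θ.Admissible F N) (hκ : 0 ≤ θ.s2.lf.κ) (hE₀ : 0 ≤ θ.s2.lf.E₀) (hB₀ : 0 ≤ θ.s2.lf.B₀)
    (w : WorldP) (hC : w.C = (datumOfRecord₁₃SepCoPH F N θ h).C) (p : B12.RunParams)
    (hN : Step.InInterval w.γ p.K (gOfRecord₁₃ F N θ.toStage13Params p) → B14.FlowIneq26 (gOfRecord₁₃ F N θ.toStage13Params p) w.βup w.β₀ p.K → SupplyChainAt θ p) :
    Dag.B14_main (leavesP w p) :=
  b14_main_at_record₁₃SepCoPH_of_liveSel F N θ p w h hC hθ hκ hE₀ hB₀ hsel fun _ _ _ _ _ hsc _ hfc =>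
    thmP245Laws_of_supplyChainAt h.toCore hsel hθ hκ hE₀ hB₀ hθ.toStage9.2.2.2
      (hN (by have h' : Step.InInterval w.γ p.K (w.C p).flow.g := hsc; rwa [hC] at h')
        (by have h' : B14.FlowIneq26 (w.C p).flow.g w.βup w.β₀ p.K := hfc; rwa [hC] at h'))

/-- **THE ∀-RUN PACKAGING** of the socket: N11's node at every run of the world from a chain family keyed on the window and (2.6). [cite: Balaban1988Convergent, Thm 1 p.262, Theorem p.245, (2.6) p.255] -/
theorem b14_main_leavesP_all_of_supplyChainAt_of_window_of_flowIneq26 (h : θ.Provisos₁₃SepCoPH F N)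
    (hsel : θ.ppSel = ppSelLiveOfRecord F N θ.ν θ.τ9 (EOfRecord₁₃ F N θ.toStage13Params) (wOfRecord₉ F N θ.toStage9Params))
    (hθ : θ.Admissible F N) (hκ : 0 ≤ θ.s2.lf.κ) (hE₀ : 0 ≤ θ.s2.lf.E₀) (hB₀ : 0 ≤ θ.s2.lf.B₀)
    (w : WorldP) (hC : w.C = (datumOfRecord₁₃SepCoPH F N θ h).C)
    (hN : ∀ P : B12.RunParams, Step.InInterval w.γ P.K (gOfRecord₁₃ F N θ.toStage13Params P) →
      B14.FlowIneq26 (gOfRecord₁₃ F N θ.toStage13Params P) w.βup w.β₀ P.K → SupplyChainAt θ P) :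
    ∀ P : B12.RunParams, Dag.B14_main (leavesP w P) := fun P =>
  b14_main_leavesP_of_supplyChainAt_of_window_of_flowIneq26 h hsel hθ hκ hE₀ hB₀ w hC P (hN P)

end Socket

/-! ## §2  THE SPLIT bg SUPPLY: K0's guarded row on the compatible initial segment, a one-block producer on the top segment -/

section Split

variable (θ : Stage13HParams F N) (p : B12.RunParams)

/-- **★★★ THE SPLIT bg SUPPLY ALONG A WINDOWED (2.6)-RUN** (`M = L^a`, `r = 1`; window `]0, γ′]` with `γ′ ≤ θ.γ`, (2.6) with ceiling `βup ≥ 0`, `βup·γ′² ≤ 1`): the bg facts at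
EVERY level `k ≤ K` — exactly the binder `hbgs` of this seat's H3 ∕ H5 ∕ FILE 1 — from (i) the key's GUARDED row P11 `Provisos₁₃SepCoPH.bg` at the levels `k ≤ n₀` of dag-n11-w4 g5's
compatible initial segment (`exists_lastCompatibleLevel_of_window_of_flowIneq26`: `PartCompat₁₃ θ p n₀`, hence at every `k ≤ n₀`) and (ii) a displayed ONE-BLOCK PRODUCER `hob` at the
levels whose 𝐃_k-cube exceeds the torus (every `k > n₀`).  Pure bookkeeping: one case split, no level left over. [cite: Balaban1988Convergent, (2.1) p.254, (2.5)–(2.6) p.255, p.257 («compatible»), (2.28) p.259; Balaban1987RG1, (0.20) p.256, (0.1) p.251; Balaban1985Variational, Thm 1 (7)–(8) pp.278–279] -/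
theorem bgFacts_of_guardedRow_of_oneBlockSupply_of_flowIneq26 (h : θ.Provisos₁₃SepCoPH F N) {a : ℕ} (hMa : θ.τ9.M = F.L ^ a) (hr : θ.ν.r = 1)
    {γ' βup β₀ : ℝ} (hβ : 0 ≤ βup) (hβγ : βup * γ' ^ 2 ≤ 1) (hγ' : γ' ≤ θ.γ)
    (hW : Step.InInterval γ' p.K (gOfRecord₁₃ F N θ.toStage13Params p)) (h26 : B14.FlowIneq26 (gOfRecord₁₃ F N θ.toStage13Params p) βup β₀ p.K)
    (hob : ∀ k, k ≤ p.K →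
      (F.P p.K).sitesPerDir 0 < dCubeSide (F.P p.K).L θ.τ9.M (RkOfRecord (F.P p.K).L θ.ν.r (gOfRecord₁₃ F N θ.toStage13Params p k)) k →
      BgProvisoΛ F N p.K (settingOfRecord₁₃ F N θ.toStage13Params p) (θ.Rz p.K) θ.τ9.M k (suppOfRecord₁₃SepCoP F N θ.toStage13Params p k)
        (UbgOfRecord₁₃CoP F N θ.toStage13Params p k)) :
    ∀ k, k ≤ p.K → BgProvisoΛ F N p.K (settingOfRecord₁₃ F N θ.toStage13Params p) (θ.Rz p.K) θ.τ9.M k (suppOfRecord₁₃SepCoP F N θ.toStage13Params p k)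
      (UbgOfRecord₁₃CoP F N θ.toStage13Params p k) := by
  obtain ⟨n₀, -, hPC, htail⟩ := exists_lastCompatibleLevel_of_window_of_flowIneq26 θ.toStage13Params hMa hr p hβ hβγ hW h26
  intro k hk
  by_cases hkn : k ≤ n₀
  · exact h.bg p k hk (fun j hj => ⟨(hW j (hj.trans hk)).1, (hW j (hj.trans hk)).2.trans hγ'⟩) (fun j h1 hj => hPC j h1 (hj.trans hkn))
  · exact hob k hk (htail k (not_le.mp hkn) hk)

end Split

/-! ## §3  N11's node on EVERY window run on the SupplierBorel road: H3's token with the bg facts from the split supply -/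

section Node

variable (θ : Stage13HParams F N)

section PerRun

variable (p : B12.RunParams)

/-- **★★★ N11's DAG NODE `Dag.B14_main (leavesP w p)` ON THE SupplierBorel ROAD FOR A WINDOW RUN — K0's GUARDED ROW BELOW THE SPLIT, A ONE-BLOCK PRODUCER ABOVE IT, NO GUARD BINDER**
(world bound to the K1-keyed SepCoPH datum of a Gaussian-class `θ` on the live-selector line, `w.γ ≤ θ.γ`, `0 ≤ w.βup`, `w.βup·w.γ² ≤ 1`; `M = L^a`, `r = 1`): §1's socket with the
chain DISCHARGED by this seat's H3 token `supplyChainAt_of_gaussCert_of_supplierBorel_of_bgFacts_of_powM`, whose bg-fact binder is served by §2 from the node's own window + (2.6).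
Displayed for the run: the five numeric rows, K0's per-cube [15]-solvability, [III] §3's supplier with `SupplierObligations ∧ SupplierBorel`, and the ONE-BLOCK PRODUCER `hob`; θ-level:
certificate, key, `0 < M₁ ≤ M`, `2 ≤ cR`, `L·M₂ ∣ M`.  FILE 1's `hbgs` SHRUNK to the one-block levels; FILE 5's top-cube restriction GONE. [cite: Balaban1988Convergent, Thm 1 p.262, Theorem p.245, p.244 L36–38, §3 p.279, (2.5)–(2.6) p.255, p.257, (2.28) p.259, (3.24)–(3.25) p.270; Balaban1987RG1, Thm 1 p.259, (0.20) p.256; Balaban1989LargeFieldI, (0.3)–(0.4) p.176, p.177 (i)–(ii); Balaban1985Variational, Thm 1 (7)–(8) pp.278–279] -/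
theorem b14_main_leavesP_of_gaussCert_of_supplierBorel_of_oneBlockSupply_of_powM
    (hζ : ∀ (p' : B12.RunParams) (n : ℕ) (Ω Λ : ℕ → Set (Site (F.P p'.K) 0)), (θ.Zh p' n Ω Λ).ζ0 = (ZhPinOfRecord₁₃ θ.toStage13Params p' Ω Λ).ζ0)
    (hq : ∀ (p' : B12.RunParams) (n : ℕ) (Ω Λ : ℕ → Set (Site (F.P p'.K) 0)) (j : ℕ) (Λ' : Set (Site (F.P p'.K) 0)) (ω : MultiCfg (F.P p'.K) (SU N) (FluctV N)),
      (θ.Zh p' n Ω Λ).quad j Λ' ω = ∑ b ∈ (Set.toFinite (bondsIn j (Λ'ᶜ ∩ Ω (j + 1)))).toFinset, ‖(ω j).2 b‖ ^ 2)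
    (h : θ.Provisos₁₃SepCoPH F N) (hsel : θ.ppSel = ppSelLiveOfRecord F N θ.ν θ.τ9 (EOfRecord₁₃ F N θ.toStage13Params) (wOfRecord₉ F N θ.toStage9Params))
    (hθ : θ.Admissible F N) (hκ : 0 ≤ θ.s2.lf.κ) (hE₀ : 0 ≤ θ.s2.lf.E₀) (hB₀ : 0 ≤ θ.s2.lf.B₀)
    (hM₁ : 0 < θ.ν.M₁) (hle : θ.ν.M₁ ≤ θ.τ9.M) (hcR : 2 ≤ θ.s2.cR) (hdiv : F.L * θ.ν.M₂ ∣ θ.τ9.M) {a : ℕ} (hMa : θ.τ9.M = F.L ^ a) (hr : θ.ν.r = 1)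
    (h3 : ∀ j, 1 ≤ j → j ≤ p.K →
      3 * side (F.P p.K).L θ.ν.M₁ j ≤ cubeSide (F.P p.K).L θ.ν.M₂ (RkOfRecord (F.P p.K).L θ.ν.r (gOfRecord₁₃ F N θ.toStage13Params p j)) j)
    (hR : ∀ j, 1 ≤ j → j ≤ p.K → (F.P p.K).L ^ j + (((F.P p.K).d + 4) * (F.P p.K).L + 2) * (∑ l ∈ Finset.range j, (F.P p.K).L ^ l) + 2 ≤
      cubeSide (F.P p.K).L θ.ν.M₂ (RkOfRecord (F.P p.K).L θ.ν.r (gOfRecord₁₃ F N θ.toStage13Params p j)) j)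
    (hε : ∀ j, 1 ≤ j → j ≤ p.K → 0 < epsOfRecord θ.ν (gOfRecord₁₃ F N θ.toStage13Params p) j)
    (hε3 : ∀ j, 1 ≤ j → j ≤ p.K → (143 * (((((F.P p.K).d + 4 : ℕ) : ℝ)) ^ 2 / 4) ^ 2) * epsOfRecord θ.ν (gOfRecord₁₃ F N θ.toStage13Params p) j ≤ 1 / 3)
    (hε2 : ∀ j, 1 ≤ j → j ≤ p.K →
      2 * epsOfRecord θ.ν (gOfRecord₁₃ F N θ.toStage13Params p) j ≤ 2 * ExpMeanLog.deltaSU (Fin N) / ((((F.P p.K).d + 4) * (F.P p.K).L : ℕ) : ℝ) ^ 2)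
    (hsolv : ∀ j, 1 ≤ j → j ≤ p.K → ∀ (s : SeqOfRecord F θ.ν θ.τ9.M (gOfRecord₁₃ F N θ.toStage13Params p) p.K j) (V : GaugeField (F.P p.K) j (SU N)),
      chiSeqOfRecord F N θ.ν θ.τ9.M (gOfRecord₁₃ F N θ.toStage13Params p) p.K j s V ≠ 0 →
      ∀ a ∈ cubesIn (fun a : ↥(cubeIndices (F.P p.K) (cubeSide (F.P p.K).L θ.ν.M₂ (RkOfRecord (F.P p.K).L θ.ν.r (gOfRecord₁₃ F N θ.toStage13Params p j)) j)) =>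
          cubeEnl (F.P p.K) (cubeSide (F.P p.K).L θ.ν.M₂ (RkOfRecord (F.P p.K).L θ.ν.r (gOfRecord₁₃ F N θ.toStage13Params p j)) j) a 0) (s.Ω j),
        ∃ U₀, IsMinimizer (avOfRecord F N p.K) {U | PlaqSmall (θ.ν.εreg * (F.P p.K).eta j ^ 2) U}
          (Bj θ.ν.M₁ (cubeEnl (F.P p.K) (cubeSide (F.P p.K).L θ.ν.M₂ (RkOfRecord (F.P p.K).L θ.ν.r (gOfRecord₁₃ F N θ.toStage13Params p j)) j) a 4) j)
          (avgFamily (avOfRecord F N p.K) (qsstarGIter0 j V)) U₀)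
    (σ : Sect3Supplier θ p) (hσ : SupplierObligations θ p σ) (hσB : SupplierBorel θ p σ)
    (hob : ∀ k, k ≤ p.K →
      (F.P p.K).sitesPerDir 0 < dCubeSide (F.P p.K).L θ.τ9.M (RkOfRecord (F.P p.K).L θ.ν.r (gOfRecord₁₃ F N θ.toStage13Params p k)) k →
      BgProvisoΛ F N p.K (settingOfRecord₁₃ F N θ.toStage13Params p) (θ.Rz p.K) θ.τ9.M k (suppOfRecord₁₃SepCoP F N θ.toStage13Params p k)
        (UbgOfRecord₁₃CoP F N θ.toStage13Params p k))
    (w : WorldP) (hC : w.C = (datumOfRecord₁₃SepCoPH F N θ h).C) (hγw : w.γ ≤ θ.γ) (hβ : 0 ≤ w.βup) (hβγ : w.βup * w.γ ^ 2 ≤ 1) :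
    Dag.B14_main (leavesP w p) :=
  b14_main_leavesP_of_supplyChainAt_of_window_of_flowIneq26 h hsel hθ hκ hE₀ hB₀ w hC p fun hw h26 =>
    supplyChainAt_of_gaussCert_of_supplierBorel_of_bgFacts_of_powM θ p hζ hq h.toCore hθ hM₁ hle hcR
      (fun j hj => ⟨(hw j hj).1, (hw j hj).2.trans hγw⟩)
      (bgFacts_of_guardedRow_of_oneBlockSupply_of_flowIneq26 θ p h hMa hr hβ hβγ hγw hw h26 hob) hdiv hMa h3 hR hε hε3 hε2 hsolv σ hσ hσB

end PerRun

/-- **★★★ N11's NODE AT EVERY RUN OF THE WORLD ON THE SupplierBorel ROAD — SPLIT bg SUPPLY, NO GUARD BINDER, NO ALL-LEVELS bg BINDER** (rows keyed on the window `]0, θ.γ]` as in H5;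
world `w.γ ≤ θ.γ`, `0 ≤ w.βup`, `w.βup·w.γ² ≤ 1`): this is the N11 conjunct of `Nodes (leavesP w P)` that K1⁹ v9's stub 1 reads, on this road, with the bg content asked ONLY where the
record's partition is one-block. [cite: Balaban1988Convergent, Thm 1 p.262, Theorem p.245, p.244 L36–38, §3 p.279, (2.5)–(2.6) p.255, p.257, (2.28) p.259, (3.24)–(3.25) p.270; Balaban1987RG1, Thm 1 p.259, (0.20) p.256; Balaban1989LargeFieldII, Introduction pp.355–356; Balaban1989LargeFieldI, (0.3)–(0.4) p.176; Balaban1985Variational, Thm 1 (7)–(8) pp.278–279] -/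
theorem b14_main_leavesP_all_of_gaussCert_of_supplierBorel_of_oneBlockSupply_of_powM
    (hζ : ∀ (p : B12.RunParams) (n : ℕ) (Ω Λ : ℕ → Set (Site (F.P p.K) 0)), (θ.Zh p n Ω Λ).ζ0 = (ZhPinOfRecord₁₃ θ.toStage13Params p Ω Λ).ζ0)
    (hq : ∀ (p : B12.RunParams) (n : ℕ) (Ω Λ : ℕ → Set (Site (F.P p.K) 0)) (j : ℕ) (Λ' : Set (Site (F.P p.K) 0)) (ω : MultiCfg (F.P p.K) (SU N) (FluctV N)),
      (θ.Zh p n Ω Λ).quad j Λ' ω = ∑ b ∈ (Set.toFinite (bondsIn j (Λ'ᶜ ∩ Ω (j + 1)))).toFinset, ‖(ω j).2 b‖ ^ 2)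
    (h : θ.Provisos₁₃SepCoPH F N) (hsel : θ.ppSel = ppSelLiveOfRecord F N θ.ν θ.τ9 (EOfRecord₁₃ F N θ.toStage13Params) (wOfRecord₉ F N θ.toStage9Params))
    (hθ : θ.Admissible F N) (hκ : 0 ≤ θ.s2.lf.κ) (hE₀ : 0 ≤ θ.s2.lf.E₀) (hB₀ : 0 ≤ θ.s2.lf.B₀)
    (hM₁ : 0 < θ.ν.M₁) (hle : θ.ν.M₁ ≤ θ.τ9.M) (hcR : 2 ≤ θ.s2.cR) (hdiv : F.L * θ.ν.M₂ ∣ θ.τ9.M) {a : ℕ} (hMa : θ.τ9.M = F.L ^ a) (hr : θ.ν.r = 1)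
    (h3 : ∀ P : B12.RunParams, Step.InInterval θ.γ P.K (gOfRecord₁₃ F N θ.toStage13Params P) → ∀ j, 1 ≤ j → j ≤ P.K →
      3 * side (F.P P.K).L θ.ν.M₁ j ≤ cubeSide (F.P P.K).L θ.ν.M₂ (RkOfRecord (F.P P.K).L θ.ν.r (gOfRecord₁₃ F N θ.toStage13Params P j)) j)
    (hR : ∀ P : B12.RunParams, Step.InInterval θ.γ P.K (gOfRecord₁₃ F N θ.toStage13Params P) → ∀ j, 1 ≤ j → j ≤ P.K →
      (F.P P.K).L ^ j + (((F.P P.K).d + 4) * (F.P P.K).L + 2) * (∑ l ∈ Finset.range j, (F.P P.K).L ^ l) + 2 ≤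
        cubeSide (F.P P.K).L θ.ν.M₂ (RkOfRecord (F.P P.K).L θ.ν.r (gOfRecord₁₃ F N θ.toStage13Params P j)) j)
    (hε : ∀ P : B12.RunParams, Step.InInterval θ.γ P.K (gOfRecord₁₃ F N θ.toStage13Params P) → ∀ j, 1 ≤ j → j ≤ P.K →
      0 < epsOfRecord θ.ν (gOfRecord₁₃ F N θ.toStage13Params P) j)
    (hε3 : ∀ P : B12.RunParams, Step.InInterval θ.γ P.K (gOfRecord₁₃ F N θ.toStage13Params P) → ∀ j, 1 ≤ j → j ≤ P.K →
      (143 * (((((F.P P.K).d + 4 : ℕ) : ℝ)) ^ 2 / 4) ^ 2) * epsOfRecord θ.ν (gOfRecord₁₃ F N θ.toStage13Params P) j ≤ 1 / 3)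
    (hε2 : ∀ P : B12.RunParams, Step.InInterval θ.γ P.K (gOfRecord₁₃ F N θ.toStage13Params P) → ∀ j, 1 ≤ j → j ≤ P.K →
      2 * epsOfRecord θ.ν (gOfRecord₁₃ F N θ.toStage13Params P) j ≤ 2 * ExpMeanLog.deltaSU (Fin N) / ((((F.P P.K).d + 4) * (F.P P.K).L : ℕ) : ℝ) ^ 2)
    (hsolv : ∀ P : B12.RunParams, Step.InInterval θ.γ P.K (gOfRecord₁₃ F N θ.toStage13Params P) → ∀ j, 1 ≤ j → j ≤ P.K →
      ∀ (s : SeqOfRecord F θ.ν θ.τ9.M (gOfRecord₁₃ F N θ.toStage13Params P) P.K j) (V : GaugeField (F.P P.K) j (SU N)),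
      chiSeqOfRecord F N θ.ν θ.τ9.M (gOfRecord₁₃ F N θ.toStage13Params P) P.K j s V ≠ 0 →
      ∀ a ∈ cubesIn (fun a : ↥(cubeIndices (F.P P.K) (cubeSide (F.P P.K).L θ.ν.M₂ (RkOfRecord (F.P P.K).L θ.ν.r (gOfRecord₁₃ F N θ.toStage13Params P j)) j)) =>
          cubeEnl (F.P P.K) (cubeSide (F.P P.K).L θ.ν.M₂ (RkOfRecord (F.P P.K).L θ.ν.r (gOfRecord₁₃ F N θ.toStage13Params P j)) j) a 0) (s.Ω j),
        ∃ U₀, IsMinimizer (avOfRecord F N P.K) {U | PlaqSmall (θ.ν.εreg * (F.P P.K).eta j ^ 2) U}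
          (Bj θ.ν.M₁ (cubeEnl (F.P P.K) (cubeSide (F.P P.K).L θ.ν.M₂ (RkOfRecord (F.P P.K).L θ.ν.r (gOfRecord₁₃ F N θ.toStage13Params P j)) j) a 4) j)
          (avgFamily (avOfRecord F N P.K) (qsstarGIter0 j V)) U₀)
    (σ : (P : B12.RunParams) → Sect3Supplier θ P)
    (hσ : ∀ P : B12.RunParams, Step.InInterval θ.γ P.K (gOfRecord₁₃ F N θ.toStage13Params P) → SupplierObligations θ P (σ P))
    (hσB : ∀ P : B12.RunParams, Step.InInterval θ.γ P.K (gOfRecord₁₃ F N θ.toStage13Params P) → SupplierBorel θ P (σ P))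
    (hob : ∀ P : B12.RunParams, Step.InInterval θ.γ P.K (gOfRecord₁₃ F N θ.toStage13Params P) → ∀ k, k ≤ P.K →
      (F.P P.K).sitesPerDir 0 < dCubeSide (F.P P.K).L θ.τ9.M (RkOfRecord (F.P P.K).L θ.ν.r (gOfRecord₁₃ F N θ.toStage13Params P k)) k →
      BgProvisoΛ F N P.K (settingOfRecord₁₃ F N θ.toStage13Params P) (θ.Rz P.K) θ.τ9.M k (suppOfRecord₁₃SepCoP F N θ.toStage13Params P k)
        (UbgOfRecord₁₃CoP F N θ.toStage13Params P k))
    (w : WorldP) (hC : w.C = (datumOfRecord₁₃SepCoPH F N θ h).C) (hγw : w.γ ≤ θ.γ) (hβ : 0 ≤ w.βup) (hβγ : w.βup * w.γ ^ 2 ≤ 1) :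
    ∀ P : B12.RunParams, Dag.B14_main (leavesP w P) := fun P =>
  b14_main_leavesP_of_supplyChainAt_of_window_of_flowIneq26 h hsel hθ hκ hE₀ hB₀ w hC P fun hw h26 =>
    have hW : Step.InInterval θ.γ P.K (gOfRecord₁₃ F N θ.toStage13Params P) := fun j hj => ⟨(hw j hj).1, (hw j hj).2.trans hγw⟩
    supplyChainAt_of_gaussCert_of_supplierBorel_of_bgFacts_of_powM θ P hζ hq h.toCore hθ hM₁ hle hcR hW
      (bgFacts_of_guardedRow_of_oneBlockSupply_of_flowIneq26 θ P h hMa hr hβ hβγ hγw hw h26 (hob P hW)) hdiv hMa (h3 P hW) (hR P hW)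
      (hε P hW) (hε3 P hW) (hε2 P hW) (hsolv P hW) (σ P) (hσ P hW) (hσB P hW)

end Node

/-! ## §4  The edition at the NAMED Gaussian certificate `gaussPinH θ` — no class hypothesis -/

section Named

variable (θ : Stage13HParams F N)

/-- **★★ N11's NODE AT EVERY RUN AT A WORLD BOUND TO THE K1-KEYED DATUM OF `gaussPinH θ` — SPLIT bg SUPPLY** (§3 with `gaussPinH_ζ0 ∕ gaussPinH_quad` (`rfl`) and the key by
`provisos₁₃SepCoPH_gaussPinH`; rows over `θ`'s Stage-13 letters). [cite: Balaban1988Convergent, Thm 1 p.262, Theorem p.245, p.244 L36–38, §3 p.279, (2.6) p.255, p.257, (2.28) p.259, (3.16) p.268; Balaban1987RG1, Thm 1 p.259; Balaban1989LargeFieldI, (0.3)–(0.4) p.176; Balaban1985Variational, Thm 1 (7)–(8) pp.278–279] -/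
theorem b14_main_leavesP_all_gaussPinH_of_supplierBorel_of_oneBlockSupply_of_powM
    (h : θ.Provisos₁₃SepCoPH F N) (hsel : θ.ppSel = ppSelLiveOfRecord F N θ.ν θ.τ9 (EOfRecord₁₃ F N θ.toStage13Params) (wOfRecord₉ F N θ.toStage9Params))
    (hθ : θ.Admissible F N) (hκ : 0 ≤ θ.s2.lf.κ) (hE₀ : 0 ≤ θ.s2.lf.E₀) (hB₀ : 0 ≤ θ.s2.lf.B₀)
    (hM₁ : 0 < θ.ν.M₁) (hle : θ.ν.M₁ ≤ θ.τ9.M) (hcR : 2 ≤ θ.s2.cR) (hdiv : F.L * θ.ν.M₂ ∣ θ.τ9.M) {a : ℕ} (hMa : θ.τ9.M = F.L ^ a) (hr : θ.ν.r = 1)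
    (h3 : ∀ P : B12.RunParams, Step.InInterval θ.γ P.K (gOfRecord₁₃ F N θ.toStage13Params P) → ∀ j, 1 ≤ j → j ≤ P.K →
      3 * side (F.P P.K).L θ.toStage13Params.ν.M₁ j ≤ cubeSide (F.P P.K).L θ.toStage13Params.ν.M₂ (RkOfRecord (F.P P.K).L θ.toStage13Params.ν.r (gOfRecord₁₃ F N θ.toStage13Params P j)) j)
    (hR : ∀ P : B12.RunParams, Step.InInterval θ.γ P.K (gOfRecord₁₃ F N θ.toStage13Params P) → ∀ j, 1 ≤ j → j ≤ P.K →
      (F.P P.K).L ^ j + (((F.P P.K).d + 4) * (F.P P.K).L + 2) * (∑ l ∈ Finset.range j, (F.P P.K).L ^ l) + 2 ≤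
        cubeSide (F.P P.K).L θ.toStage13Params.ν.M₂ (RkOfRecord (F.P P.K).L θ.toStage13Params.ν.r (gOfRecord₁₃ F N θ.toStage13Params P j)) j)
    (hε : ∀ P : B12.RunParams, Step.InInterval θ.γ P.K (gOfRecord₁₃ F N θ.toStage13Params P) → ∀ j, 1 ≤ j → j ≤ P.K →
      0 < epsOfRecord θ.toStage13Params.ν (gOfRecord₁₃ F N θ.toStage13Params P) j)
    (hε3 : ∀ P : B12.RunParams, Step.InInterval θ.γ P.K (gOfRecord₁₃ F N θ.toStage13Params P) → ∀ j, 1 ≤ j → j ≤ P.K →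
      (143 * (((((F.P P.K).d + 4 : ℕ) : ℝ)) ^ 2 / 4) ^ 2) * epsOfRecord θ.toStage13Params.ν (gOfRecord₁₃ F N θ.toStage13Params P) j ≤ 1 / 3)
    (hε2 : ∀ P : B12.RunParams, Step.InInterval θ.γ P.K (gOfRecord₁₃ F N θ.toStage13Params P) → ∀ j, 1 ≤ j → j ≤ P.K →
      2 * epsOfRecord θ.toStage13Params.ν (gOfRecord₁₃ F N θ.toStage13Params P) j ≤ 2 * ExpMeanLog.deltaSU (Fin N) / ((((F.P P.K).d + 4) * (F.P P.K).L : ℕ) : ℝ) ^ 2)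
    (hsolv : ∀ P : B12.RunParams, Step.InInterval θ.γ P.K (gOfRecord₁₃ F N θ.toStage13Params P) → ∀ j, 1 ≤ j → j ≤ P.K →
      ∀ (s : SeqOfRecord F θ.toStage13Params.ν θ.toStage13Params.τ9.M (gOfRecord₁₃ F N θ.toStage13Params P) P.K j) (V : GaugeField (F.P P.K) j (SU N)),
      chiSeqOfRecord F N θ.toStage13Params.ν θ.toStage13Params.τ9.M (gOfRecord₁₃ F N θ.toStage13Params P) P.K j s V ≠ 0 →
      ∀ a ∈ cubesIn (fun a : ↥(cubeIndices (F.P P.K) (cubeSide (F.P P.K).L θ.toStage13Params.ν.M₂ (RkOfRecord (F.P P.K).L θ.toStage13Params.ν.r (gOfRecord₁₃ F N θ.toStage13Params P j)) j)) =>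
          cubeEnl (F.P P.K) (cubeSide (F.P P.K).L θ.toStage13Params.ν.M₂ (RkOfRecord (F.P P.K).L θ.toStage13Params.ν.r (gOfRecord₁₃ F N θ.toStage13Params P j)) j) a 0) (s.Ω j),
        ∃ U₀, IsMinimizer (avOfRecord F N P.K) {U | PlaqSmall (θ.toStage13Params.ν.εreg * (F.P P.K).eta j ^ 2) U}
          (Bj θ.toStage13Params.ν.M₁ (cubeEnl (F.P P.K) (cubeSide (F.P P.K).L θ.toStage13Params.ν.M₂ (RkOfRecord (F.P P.K).L θ.toStage13Params.ν.r (gOfRecord₁₃ F N θ.toStage13Params P j)) j) a 4) j)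
          (avgFamily (avOfRecord F N P.K) (qsstarGIter0 j V)) U₀)
    (σ : (P : B12.RunParams) → Sect3Supplier (gaussPinH θ) P)
    (hσ : ∀ P : B12.RunParams, Step.InInterval θ.γ P.K (gOfRecord₁₃ F N θ.toStage13Params P) → SupplierObligations (gaussPinH θ) P (σ P))
    (hσB : ∀ P : B12.RunParams, Step.InInterval θ.γ P.K (gOfRecord₁₃ F N θ.toStage13Params P) → SupplierBorel (gaussPinH θ) P (σ P))
    (hob : ∀ P : B12.RunParams, Step.InInterval θ.γ P.K (gOfRecord₁₃ F N θ.toStage13Params P) → ∀ k, k ≤ P.K →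
      (F.P P.K).sitesPerDir 0 < dCubeSide (F.P P.K).L θ.toStage13Params.τ9.M (RkOfRecord (F.P P.K).L θ.toStage13Params.ν.r (gOfRecord₁₃ F N θ.toStage13Params P k)) k →
      BgProvisoΛ F N P.K (settingOfRecord₁₃ F N θ.toStage13Params P) (θ.Rz P.K) θ.toStage13Params.τ9.M k (suppOfRecord₁₃SepCoP F N θ.toStage13Params P k)
        (UbgOfRecord₁₃CoP F N θ.toStage13Params P k))
    (w : WorldP) (hC : w.C = (datumOfRecord₁₃SepCoPH F N (gaussPinH θ) (provisos₁₃SepCoPH_gaussPinH h)).C) (hγw : w.γ ≤ θ.γ) (hβ : 0 ≤ w.βup)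
    (hβγ : w.βup * w.γ ^ 2 ≤ 1) : ∀ P : B12.RunParams, Dag.B14_main (leavesP w P) :=
  b14_main_leavesP_all_of_gaussCert_of_supplierBorel_of_oneBlockSupply_of_powM (gaussPinH θ) (gaussPinH_ζ0 θ) (gaussPinH_quad θ) (provisos₁₃SepCoPH_gaussPinH h) hsel
    hθ hκ hE₀ hB₀ hM₁ hle hcR hdiv hMa hr h3 hR hε hε3 hε2 hsolv σ hσ hσB hob w hC hγw hβ hβγ

end Named

end Summit.QuantumFields.YangMills.Theorems.BalabanUVNodesN11NodeFaceOfSplitBgSupplierBorel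

end
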